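import Mathlib
import HarnessLib

set_option linter.dupNamespace false

/-!
# Reduction of the inline tight-closure clause to `𝔪`-primary ideals (crux `FrobeniusLadder.FRationalResolution`, line `Sketch`)

Stub `stub_clause_of_mPrimary` of the skeleton `Sketch` for crux stmt-ResolutionOfSingularities-15317.
An ideal `I` of a ring of characteristic `p` is "tightly closed (inline)" when
`∀ y c, c ≠ 0 → (∀ e, c * y ^ (p ^ e) ∈ span {z ^ (p ^ e) | z ∈ I}) → y ∈ I`.
In a Noetherian local ring `(R, 𝔪)`, if every ideal containing a power of `𝔪` is tightly closed
(inline), then every ideal is: for each `N` the hypothesis transfers to `I ⊔ 𝔪 ^ N` by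
monotonicity of `J ↦ span ((· ^ (p ^ e)) '' J)`, so `y ∈ I ⊔ 𝔪 ^ N` for every `N`, and Krull's
intersection theorem `⋂ₙ (I + 𝔪ⁿ) = I` (Mathlib: the finite `R`-module `R ⧸ I` is `𝔪`-adically
separated, `IsHausdorff (maximalIdeal R) (R ⧸ I)`) gives `y ∈ I`.
-/

namespace Summit.ResolutionOfSingularities.ResolutionOfSingularities.Theorems.FRationalResolution

open IsLocalRing

/-- **Krull's intersection theorem for `R ⧸ J`.** In a Noetherian local ring `(R, 𝔪)`, an element
lying in `J ⊔ 𝔪 ^ n` for every `n` lies in `J`, i.e. `⋂ₙ (J + 𝔪ⁿ) = J`. -/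
theorem mem_of_forall_mem_sup_maximalIdeal_pow {R : Type*} [CommRing R] [IsNoetherianRing R]
    [IsLocalRing R] {J : Ideal R} {x : R} (h : ∀ n : ℕ, x ∈ J ⊔ maximalIdeal R ^ n) : x ∈ J := by
  -- adapted from Literature/NumberTheory/GaloisRepresentations/DeformationProfiniteLevel.lean
  -- (`mem_of_forall_mem_sup_pow`)
  rw [← Ideal.Quotient.eq_zero_iff_mem]
  refine IsHausdorff.haus (inferInstance : IsHausdorff (maximalIdeal R) (R ⧸ J)) _ fun n => ?_
  rw [SModEq.zero, Ideal.smul_top_eq_map]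
  change Ideal.Quotient.mk J x ∈ (maximalIdeal R ^ n).map (Ideal.Quotient.mk J)
  obtain ⟨y, hy, z, hz, rfl⟩ := Submodule.mem_sup.1 (h n)
  rw [map_add, Ideal.Quotient.eq_zero_iff_mem.2 hy, zero_add]
  exact Ideal.mem_map_of_mem _ hz

/-- Monotonicity of the Frobenius-power span `J ↦ span ((· ^ (p ^ e)) '' J)` in the ideal `J`. -/
theorem span_pow_image_mono {R : Type*} [CommRing R] (p e : ℕ) {I J : Ideal R} (hIJ : I ≤ J) :
    Ideal.span ((fun z : R => z ^ p ^ e) '' (I : Set R)) ≤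
      Ideal.span ((fun z : R => z ^ p ^ e) '' (J : Set R)) :=
  Ideal.span_mono (Set.image_mono (SetLike.coe_subset_coe.mpr hIJ))

/-- **REDUCTION TO `𝔪`-PRIMARY IDEALS.** In a Noetherian local ring `(R, 𝔪)`, if every ideal
containing a power of the maximal ideal is tightly closed (inline Frobenius-power clause:
`c ≠ 0 ∧ (∀ e, c · y ^ (p ^ e) ∈ span {z ^ (p ^ e) | z ∈ I}) ⇒ y ∈ I`), then every ideal of `R`
is tightly closed. Proof: apply the hypothesis to `I ⊔ 𝔪 ^ N` for every `N` and conclude by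
Krull's intersection theorem `⋂ₙ (I + 𝔪ⁿ) = I`. -/
theorem stub_clause_of_mPrimary (p : ℕ) (R : Type) [CommRing R] [IsNoetherianRing R] [IsLocalRing R]
    (h : ∀ I : Ideal R, (∃ N : ℕ, IsLocalRing.maximalIdeal R ^ N ≤ I) → ∀ y c : R, c ≠ 0 →
      (∀ e : ℕ, c * y ^ p ^ e ∈ Ideal.span ((fun z : R => z ^ p ^ e) '' (I : Set R))) → y ∈ I)
    (I : Ideal R) (y c : R) (hc : c ≠ 0)
    (hy : ∀ e : ℕ, c * y ^ p ^ e ∈ Ideal.span ((fun z : R => z ^ p ^ e) '' (I : Set R))) :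
    y ∈ I :=
  mem_of_forall_mem_sup_maximalIdeal_pow fun N =>
    h (I ⊔ maximalIdeal R ^ N) ⟨N, le_sup_right⟩ y c hc fun e =>
      span_pow_image_mono p e le_sup_left (hy e)

end Summit.ResolutionOfSingularities.ResolutionOfSingularities.Theorems.FRationalResolution
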